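/-
Copyright: the b2b-balaban cell (near-miss cell 7), T⁴-continuum fan-out, lineage t4-ne7b-p3 (node U5c LARGE-DEVIATION
member P3).  Released under the licence of the surrounding project.
-/
import Mathlib.Combinatorics.SimpleGraph.Acyclic
import Mathlib.Combinatorics.SimpleGraph.DegreeSum
import Summits.QuantumFields.BalabanUV.T4Continuum.Support.SpaceTimePeierlsLeaves

/-!
# Space-time Peierls ∕ Cramér route for NE7b — leaf A1 PROVED: the site-animal bound `SiteAnimalBound Δ (Δ+1)²`

Summits-side support leaf of the T⁴-continuum cell (rung (B)+1 on a FINITE torus only; NOT infinite volume, NOT the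
mass gap, NOT the Clay statement; NOT a proof of the spine estimate NE7b).  Lineage `t4-ne7b-p3` (generation 1), node
U5c, skeleton `t4/skeletons/NE7b-t4-ne7b-p3.md` row ST1 (leaf A1).  [folklore] finite graph combinatorics, Mathlib only
(+ the leaf's statement from `SpaceTimePeierlsLeaves`); nothing is quoted from print and nothing printed is asserted;
no `[cite:]` tag.

THEOREM (`siteAnimalBound_sq`).  In a finite simple graph all of whose degrees are `≤ Δ`, the connected induced
vertex sets of size `n` containing a fixed vertex `v` number at most `((Δ+1)²)ⁿ` — i.e. `SiteAnimalBound Δ ((Δ+1)²)`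
(the classical asymptotics is `(eΔ)ⁿ`, Lyons–Peres *Probability on Trees and Networks* Ex. 7.39; any exponential
bound serves the route, whose survival condition reads `log Δ₁ < s₁`).

PROOF (the closed-walk encoding).  §1 `chains G ℓ v` = the vertex lists of the walks of length `ℓ` from `v`; there
are `≤ Δ^ℓ` of them (`card_chains_le`) and every walk's support is one (`support_mem_chains`).  §2 every connected
`S ∋ v` carries a CLOSED WALK at `v` of length `2(#S − 1)` whose support is exactly `S` (`exists_covering_walk`):
remove a non-cut vertex `u ≠ v` of the induced graph (a degree-one vertex `≠ v` of a spanning tree — two leaves by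
the degree sum, Mathlib's `Connected.exists_isTree_le`, `IsTree.card_edgeFinset`,
`Connected.induce_compl_singleton_of_degree_eq_one`), cover `S ∖ {u}` by induction, and splice the detour
`x → u → x` at a neighbour `x` of `u`.  §3 hence the animals through `v` of size `n` inject (via the support set) into
the image of `chains G (2n−2) v`: at most `Δ^{2n−2} ≤ ((Δ+1)²)ⁿ`.

HONEST DEPENDENCY (cell, verbatim): continuum YM on T⁴ ⇐ BetaPertH ∧ nine spine estimates (0/9 proved); BetaPertH ⇐
(D1) ∧ (D4) ∧ CAP+tail; G-an2-4 gates asym, D1 and NE2/3/4.  This file changes none of it.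
-/

open Finset

namespace Summit.QuantumFields.BalabanUV.T4Continuum.SpaceTimePeierls

open SpaceTimePeierlsLeaves SimpleGraph

section Animals

variable {V : Type} [DecidableEq V] (G : SimpleGraph V)

/-! ## §1 Vertex lists of walks: at most `Δ^ℓ` of length `ℓ` from a vertex -/

section Chains

variable [Fintype V] [DecidableRel G.Adj]

/-- `chains G ℓ v`: the vertex lists `[v, v₁, …, v_ℓ]` of the walks of length `ℓ` starting at `v`. [folklore] -/
def chains : ℕ → V → Finset (List V)
  | 0, v => {[v]}
  | ℓ + 1, v => (G.neighborFinset v).biUnion fun w => (chains ℓ w).image (List.cons v)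

/-- With all degrees `≤ Δ` there are at most `Δ^ℓ` vertex lists of walks of length `ℓ` from any vertex. [folklore] -/
theorem card_chains_le {Δ : ℕ} (hdeg : ∀ v, G.degree v ≤ Δ) : ∀ (ℓ : ℕ) (v : V), (chains G ℓ v).card ≤ Δ ^ ℓ
  | 0, v => by simp [chains]
  | ℓ + 1, v => by
    calc (chains G (ℓ + 1) v).card
        ≤ ∑ w ∈ G.neighborFinset v, ((chains G ℓ w).image (List.cons v)).card := card_biUnion_le
      _ ≤ ∑ w ∈ G.neighborFinset v, Δ ^ ℓ :=
          sum_le_sum fun w _ => card_image_le.trans (card_chains_le hdeg ℓ w)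
      _ = G.degree v * Δ ^ ℓ := by rw [sum_const, smul_eq_mul, card_neighborFinset_eq_degree]
      _ ≤ Δ * Δ ^ ℓ := Nat.mul_le_mul_right _ (hdeg v)
      _ = Δ ^ (ℓ + 1) := by rw [pow_succ, mul_comm]

/-- The support of a walk of length `ℓ` from `v` is one of the `chains G ℓ v`. [folklore] -/
theorem support_mem_chains : ∀ {v w : V} (p : G.Walk v w), p.support ∈ chains G p.length v
  | _, _, .nil => by simp [chains]
  | _, _, .cons h p => by
    rw [Walk.support_cons, Walk.length_cons, chains, mem_biUnion]
    exact ⟨_, (mem_neighborFinset _ _ _).2 h, mem_image.2 ⟨_, support_mem_chains p, rfl⟩⟩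

end Chains

/-! ## §2 Covering closed walks -/

/-- In a connected induced subgraph on `S` with at least two vertices there is, for every anchor `v ∈ S`, a vertex
`u ≠ v` whose removal keeps `S` connected and which has a neighbour in `S ∖ {u}` (a leaf `≠ v` of a spanning tree).
[folklore] -/
theorem exists_nonCut (S : Finset V) (hS : (G.induce (S : Set V)).Connected) (h2 : 2 ≤ S.card) {v : V}
    (hv : v ∈ S) :
    ∃ u ∈ S, u ≠ v ∧ (G.induce ((S.erase u : Finset V) : Set V)).Connected ∧ ∃ x ∈ S.erase u, G.Adj u x := by
  classical
  -- the induced graph and a spanning tree of it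
  have hfin : Finite ((S : Set V)) := (S.finite_toSet).to_subtype
  letI : Fintype ((S : Set V)) := Fintype.ofFinite _
  obtain ⟨T, hTH, hT⟩ := hS.exists_isTree_le
  have hcard : Fintype.card ((S : Set V)) = S.card := by
    rw [← Set.toFinset_card, Finset.toFinset_coe]
  haveI : Nontrivial ((S : Set V)) := by
    rw [← Fintype.one_lt_card_iff_nontrivial, hcard]; omega
  -- a degree-one vertex of the tree different from the anchor (two leaves, by the degree sum)
  let v₀ : ((S : Set V)) := ⟨v, Finset.mem_coe.2 hv⟩
  have hdeg1 : ∃ u : ((S : Set V)), u ≠ v₀ ∧ T.degree u = 1 := by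
    rcases em (∃ u : ((S : Set V)), u ≠ v₀ ∧ T.degree u = 1) with h | hall
    · exact h
    · exfalso
      have hcon : ∀ u : ((S : Set V)), u ≠ v₀ → T.degree u ≠ 1 := fun u h1 h2 => hall ⟨u, h1, h2⟩
      have hpos : ∀ u : ((S : Set V)), 1 ≤ T.degree u := fun u =>
        hT.connected.preconnected.degree_pos_of_nontrivial u
      have htwo : ∀ u ∈ (univ : Finset ((S : Set V))).erase v₀, 2 ≤ T.degree u := by
        intro u hu
        have h1 := hpos u
        have h2 := hcon u (ne_of_mem_erase hu)
        omega
      have hsum := T.sum_degrees_eq_twice_card_edges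
      have hedges := hT.card_edgeFinset
      have hsplit := Finset.add_sum_erase (univ : Finset ((S : Set V))) (fun u => T.degree u) (mem_univ v₀)
      have hle : ((univ : Finset ((S : Set V))).erase v₀).card • 2
          ≤ ∑ u ∈ (univ : Finset ((S : Set V))).erase v₀, T.degree u := card_nsmul_le_sum _ _ _ htwo
      rw [card_erase_of_mem (mem_univ _), card_univ, smul_eq_mul] at hle
      have h1 := hpos v₀
      omega
  obtain ⟨u₀, hu₀v, hdeg⟩ := hdeg1
  -- its unique tree-neighbour
  obtain ⟨w, hw, -⟩ := degree_eq_one_iff_existsUnique_adj.mp hdeg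
  have hGuw : G.Adj (u₀ : V) (w : V) := hTH hw
  have hwu : (w : V) ≠ (u₀ : V) := fun h => T.irrefl (by rwa [Subtype.ext h] at hw)
  -- removing u₀ keeps the tree, hence the induced graph, connected
  have hTconn : (T.induce ({u₀}ᶜ : Set ((S : Set V)))).Connected :=
    hT.connected.induce_compl_singleton_of_degree_eq_one hdeg
  have hHconn : ((G.induce (S : Set V)).induce ({u₀}ᶜ : Set ((S : Set V)))).Connected :=
    hTconn.mono fun a b hab => hTH hab
  -- transport along the evident surjective homomorphism onto `G.induce (S.erase u₀)`
  let φ : (G.induce (S : Set V)).induce ({u₀}ᶜ : Set ((S : Set V)))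
      →g G.induce ((S.erase (u₀ : V) : Finset V) : Set V) :=
    { toFun := fun a => ⟨(a.1 : V), Finset.mem_coe.2 (mem_erase.2
        ⟨fun h => (Set.mem_compl_singleton_iff.1 a.2) (Subtype.ext h), Finset.mem_coe.1 a.1.2⟩)⟩
      map_rel' := fun {a b} hab => hab }
  have hφ : Function.Surjective φ := by
    intro b
    have hb := mem_erase.1 (Finset.mem_coe.1 b.2)
    exact ⟨⟨⟨b.1, Finset.mem_coe.2 hb.2⟩,
      Set.mem_compl_singleton_iff.2 fun h => hb.1 (congrArg Subtype.val h)⟩, Subtype.ext rfl⟩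
  exact ⟨(u₀ : V), Finset.mem_coe.1 u₀.2, fun h => hu₀v (Subtype.ext h), hHconn.map φ hφ, (w : V),
    mem_erase.2 ⟨hwu, Finset.mem_coe.1 w.2⟩, hGuw⟩

/-- **COVERING CLOSED WALKS**: a connected induced vertex set `S ∋ v` is the support of a closed walk at `v` of length
`2(#S − 1)`. [folklore] -/
theorem exists_covering_walk : ∀ (n : ℕ) (S : Finset V), S.card = n → (G.induce (S : Set V)).Connected →
    ∀ {v : V}, v ∈ S → ∃ p : G.Walk v v, p.length + 2 = 2 * n ∧ p.support.toFinset = S := by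
  intro n
  induction n using Nat.strong_induction_on with
  | _ n ih =>
    intro S hSn hS v hv
    by_cases h1 : S.card = 1
    · -- S = {v}
      obtain ⟨a, ha⟩ := card_eq_one.1 h1
      have hva : v = a := by simpa [ha] using hv
      subst hva
      refine ⟨Walk.nil, by rw [Walk.length_nil]; omega, ?_⟩
      simp [ha]
    · have hpos : 0 < S.card := card_pos.2 ⟨v, hv⟩
      have h2 : 2 ≤ S.card := by omega
      obtain ⟨u, huS, huv, hconn, x, hx, hux⟩ := exists_nonCut G S hS h2 hv
      have hcard' : (S.erase u).card = n - 1 := by rw [card_erase_of_mem huS, hSn]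
      have hv' : v ∈ S.erase u := mem_erase.2 ⟨fun h => huv h.symm, hv⟩
      obtain ⟨p', hlen', hsupp'⟩ := ih (n - 1) (by omega) (S.erase u) hcard' hconn hv'
      have hxp : x ∈ p'.support := by rw [← List.mem_toFinset, hsupp']; exact hx
      -- splice the detour x → u → x at x
      have hspec : (p'.takeUntil x hxp).append (p'.dropUntil x hxp) = p' := p'.take_spec hxp
      let mid : G.Walk x x := Walk.cons hux.symm (Walk.cons hux Walk.nil)
      refine ⟨(p'.takeUntil x hxp).append (mid.append (p'.dropUntil x hxp)), ?_, ?_⟩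
      · have hl : (p'.takeUntil x hxp).length + (p'.dropUntil x hxp).length = p'.length := by
          rw [← Walk.length_append, hspec]
        simp only [Walk.length_append, mid, Walk.length_cons, Walk.length_nil]
        omega
      · have hs : p'.support = (p'.takeUntil x hxp).support ++ (p'.dropUntil x hxp).support.tail := by
          rw [← Walk.support_append, hspec]
        have hnew : ((p'.takeUntil x hxp).append (mid.append (p'.dropUntil x hxp))).support
            = (p'.takeUntil x hxp).support ++ (u :: x :: (p'.dropUntil x hxp).support.tail) := by
          rw [Walk.support_append, Walk.support_append]
          simp [mid]
        rw [hnew, List.toFinset_append, List.toFinset_cons, List.toFinset_cons]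
        rw [hs, List.toFinset_append] at hsupp'
        have hxS : x ∈ S := mem_of_mem_erase hx
        ext a
        constructor
        · intro ha
          simp only [mem_union, mem_insert] at ha
          rcases ha with ha | ha | ha | ha
          · exact mem_of_mem_erase (hsupp' ▸ mem_union_left _ ha)
          · exact ha ▸ huS
          · exact ha ▸ hxS
          · exact mem_of_mem_erase (hsupp' ▸ mem_union_right _ ha)
        · intro ha
          by_cases hau : a = u
          · simp [hau]
          · have : a ∈ S.erase u := mem_erase.2 ⟨hau, ha⟩
            rw [← hsupp'] at this
            simp only [mem_union, mem_insert] at this ⊢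
            rcases this with h | h
            · exact Or.inl h
            · exact Or.inr (Or.inr (Or.inr h))

/-! ## §3 Leaf A1 -/

section Final

variable [Fintype V] [DecidableRel G.Adj]

/-- **LEAF A1, PROVED**: `SiteAnimalBound Δ ((Δ+1)²)` — in a finite simple graph of maximum degree `≤ Δ` the connected
induced vertex sets of size `n` through a given vertex number at most `((Δ+1)²)ⁿ`. [folklore] -/
theorem siteAnimalBound_sq (Δ : ℕ) : SiteAnimalBound Δ (((Δ : ℝ) + 1) ^ 2) := by
  intro V _ _ G _ hdeg v n
  classical
  rw [Nat.card_eq_fintype_card]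
  rcases n with _ | k
  · -- no animal of size 0 contains v
    have h0 : Fintype.card {S : Finset V // v ∈ S ∧ S.card = 0 ∧ (G.induce (S : Set V)).Connected} = 0 :=
      Fintype.card_eq_zero_iff.2 ⟨fun S => absurd S.2.2.1 (card_pos.2 ⟨v, S.2.1⟩).ne'⟩
    rw [h0]; simp
  · -- encode by covering closed walks of length 2k
    let f : {S : Finset V // v ∈ S ∧ S.card = k + 1 ∧ (G.induce (S : Set V)).Connected} →
        ((chains G (2 * k) v).image List.toFinset) := fun S =>
      ⟨S.1, by
        obtain ⟨hvS, hc, hconn⟩ := S.2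
        obtain ⟨p, hlen, hsupp⟩ := exists_covering_walk G (k + 1) S.1 hc hconn hvS
        have hl : p.length = 2 * k := by omega
        have hmem : p.support ∈ chains G (2 * k) v := by rw [← hl]; exact support_mem_chains G p
        exact mem_image.2 ⟨p.support, hmem, hsupp⟩⟩
    have hf : Function.Injective f := by
      intro a b h
      apply Subtype.ext
      have h' := congrArg Subtype.val h
      exact h'
    calc (Fintype.card {S : Finset V // v ∈ S ∧ S.card = k + 1 ∧ (G.induce (S : Set V)).Connected} : ℝ)
        ≤ (Fintype.card ((chains G (2 * k) v).image List.toFinset) : ℝ) := by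
          exact_mod_cast Fintype.card_le_of_injective f hf
      _ = (((chains G (2 * k) v).image List.toFinset).card : ℝ) := by rw [Fintype.card_coe]
      _ ≤ ((chains G (2 * k) v).card : ℝ) := by exact_mod_cast card_image_le
      _ ≤ (Δ : ℝ) ^ (2 * k) := by exact_mod_cast card_chains_le G hdeg (2 * k) v
      _ ≤ ((Δ : ℝ) + 1) ^ (2 * k) := pow_le_pow_left₀ (by positivity) (by linarith) _
      _ ≤ ((Δ : ℝ) + 1) ^ (2 * (k + 1)) := pow_le_pow_right₀ (by linarith) (by omega)
      _ = (((Δ : ℝ) + 1) ^ 2) ^ (k + 1) := by rw [pow_mul]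

end Final

end Animals

end Summit.QuantumFields.BalabanUV.T4Continuum.SpaceTimePeierls
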